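import Mathlib
import Literature.Geometry.DiscreteGeometry.BondGraph
import Literature.MathematicalPhysics.StatisticalMechanics.Crystallization

/-!
# Charge locality: charge-freeness of a site only sees the sites within `2(1+η)·nn` of it

Stub `isChargeFree_sub_iff` (CHARGE LOCALITY) of the line `sharp-m-potential-compactness` for the crux
`PricedLinkCensus.TruncatedCensusGap` (item stmt-AtomisticToContinuum-14230).  The statement below
is the registered signature VERBATIM (self-contained over tree declarations of
`Literature/Geometry/DiscreteGeometry/BondGraph.lean`: `nearestDist`, `bondGraph`, `ringNumber`,
`IsChargeFree`).

In the SCALE-FREE bond graph `bondGraph η y` (`j ∼ k ↔ j ≠ k ∧ dist ≤ (1+η)·min (nn_j) (nn_k)`),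
whether the site `f i` of a finite configuration `y : Fin N → ℝ³` is charge-free (twelve bonds,
all ring numbers four) is unchanged when one passes to a sub-configuration `y ∘ f`
(`f : Fin M ↪ Fin N`) whose range contains every site within `2(1+η)·nn_{f i}` of `y (f i)`
(`0 ≤ η`).

## Proof layout (general index types, `[Finite ι]`)

* `nearestDist_apply_le_nearestDist_comp`, `nearestDist_comp_eq_of_attained`: restricting to a
  sub-family raises nearest-neighbour distances, and leaves them unchanged at a site one of whose
  nearest neighbours stays in the sub-family;
* `isChargeFree_comp_embedding_iff`: (a) the nearest neighbour of `f i` lies within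
  `nn ≤ 2(1+η)·nn` hence in the range, so `nn_{y∘f}(i) = nn_y(f i)`; (b) every site `f a` within
  `(1+η)·nn` of `y (f i)` has a nearest neighbour within `(1+η)·nn + nn_{f a} ≤ 2(1+η)·nn` of
  `y (f i)`, hence in the range, so its scale is unchanged too; (c) therefore the bonds at `f i`,
  and the bonds between two bond-neighbours of `f i`, are the same in `y` and in `y ∘ f`;
  (d) the neighbour set of `f i` and its intersections with the neighbour sets of the
  bond-neighbours are the `f`-images of those of `i` in `y ∘ f`, and `f` is injective
  (`Set.ncard_image_of_injective`);
* `isChargeFree_sub_iff`: the registered `Fin`-indexed form.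
-/

noncomputable section

namespace Summit.AtomisticToContinuum.Crystallization.Theorems.PricedLinkCensusTruncatedCensusGap

open Literature.MathematicalPhysics.StatisticalMechanics Literature.Geometry.DiscreteGeometry

section ChargeLocality

variable {ι κ X : Type*} [PseudoMetricSpace X]

/-- Restricting a configuration to a sub-family (an embedding of indices) can only RAISE the
nearest-neighbour distance of a site (fewer competitors), provided the sub-family has another
site. [folklore] -/
theorem nearestDist_apply_le_nearestDist_comp (y : ι → X) (f : κ ↪ ι) {a : κ}
    (ha : ∃ b, b ≠ a) : nearestDist y (f a) ≤ nearestDist (y ∘ f) a :=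
  le_nearestDist ha fun _ hb => nearestDist_le_dist y fun h => hb (f.injective h)

/-- If a nearest neighbour (in `y`) of the site `f a` belongs to the sub-family, the
nearest-neighbour distances of `f a` in `y` and of `a` in `y ∘ f` agree. [folklore] -/
theorem nearestDist_comp_eq_of_attained (y : ι → X) (f : κ ↪ ι) {a b : κ} (hb : b ≠ a)
    (hd : nearestDist y (f a) = dist (y (f a)) (y (f b))) :
    nearestDist (y ∘ f) a = nearestDist y (f a) := by
  refine le_antisymm ?_ (nearestDist_apply_le_nearestDist_comp y f ⟨b, hb⟩)
  rw [hd]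
  exact nearestDist_le_dist (y ∘ f) hb

/-- A site without bonds is not charge-free (it would need twelve). [folklore] -/
theorem not_isChargeFree_of_forall_not_adj {η : ℝ} {y : ι → X} {i : ι}
    (h : ∀ k, ¬ (bondGraph η y).Adj i k) : ¬ IsChargeFree η y i := by
  intro hc
  have he : (bondGraph η y).neighborSet i = ∅ := by
    ext k
    simp only [SimpleGraph.mem_neighborSet, Set.mem_empty_iff_false, iff_false]
    exact h k
  have h12 := hc.1
  rw [he, Set.ncard_empty] at h12
  exact absurd h12 (by norm_num)

variable [Finite ι]

/-- **Charge locality (embedding form).**  Let `0 ≤ η`, let `y : ι → X` be a finite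
configuration and `f : κ ↪ ι` a sub-family whose range contains every site within
`2(1+η)·nn_{f i}` of `y (f i)`.  Then `f i` is charge-free in `y` iff `i` is charge-free in the
sub-configuration `y ∘ f`: every bond and every ring number entering `IsChargeFree η · (f i)`
lives on sites within `(1+η)·nn_{f i}` of `y (f i)`, whose own scales are read off sites within
`2(1+η)·nn_{f i}`. [folklore] -/
theorem isChargeFree_comp_embedding_iff {η : ℝ} (hη : 0 ≤ η) (y : ι → X) (f : κ ↪ ι) (i : κ)
    (hS : ∀ k, dist (y k) (y (f i)) ≤ 2 * (1 + η) * nearestDist y (f i) → k ∈ Set.range f) :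
    IsChargeFree η y (f i) ↔ IsChargeFree η (y ∘ f) i := by
  have hη1 : (0 : ℝ) ≤ 1 + η := by linarith
  have hnn : 0 ≤ nearestDist y (f i) := nearestDist_nonneg y (f i)
  by_cases hN : ∃ k, k ≠ f i
  swap
  · -- a single site: both sides are false (no bonds at all)
    push Not at hN
    have h1 : ¬ IsChargeFree η y (f i) :=
      not_isChargeFree_of_forall_not_adj fun k hk => (bondGraph_adj.1 hk).1 (hN k).symm
    have h2 : ¬ IsChargeFree η (y ∘ f) i :=
      not_isChargeFree_of_forall_not_adj fun a ha =>
        (bondGraph_adj.1 ha).1 (f.injective (hN (f a))).symm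
    exact ⟨fun h => (h1 h).elim, fun h => (h2 h).elim⟩
  -- (a) a nearest neighbour of `f i` lies in the range, so the scale of `i` is unchanged
  have hnn_i : nearestDist (y ∘ f) i = nearestDist y (f i) := by
    obtain ⟨m, hm, hdm⟩ := exists_nearestDist_eq_dist y hN
    have hmS : m ∈ Set.range f := by
      refine hS m ?_
      rw [dist_comm, ← hdm]
      exact le_mul_of_one_le_left hnn (by linarith)
    obtain ⟨b, rfl⟩ := hmS
    exact nearestDist_comp_eq_of_attained y f (f.injective.ne_iff.1 hm) hdm
  -- (b) sites within `(1+η)·nn` of `y (f i)` are in the range, with unchanged scales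
  have hball : ∀ k, dist (y (f i)) (y k) ≤ (1 + η) * nearestDist y (f i) → k ∈ Set.range f := by
    intro k hk
    refine hS k ?_
    rw [dist_comm]
    have h0 : 0 ≤ (1 + η) * nearestDist y (f i) := mul_nonneg hη1 hnn
    linarith
  have hnn_eq : ∀ a : κ, dist (y (f i)) (y (f a)) ≤ (1 + η) * nearestDist y (f i) →
      nearestDist (y ∘ f) a = nearestDist y (f a) := by
    intro a ha
    by_cases hai : a = i
    · rw [hai]
      exact hnn_i
    have hia : f i ≠ f a := f.injective.ne (Ne.symm hai)
    obtain ⟨m, hm, hdm⟩ := exists_nearestDist_eq_dist y ⟨f i, hia⟩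
    have hmS : m ∈ Set.range f := by
      refine hS m ?_
      have h1 : nearestDist y (f a) ≤ dist (y (f a)) (y (f i)) := nearestDist_le_dist y hia
      have h2 : dist (y (f i)) (y (f a)) = dist (y (f a)) (y (f i)) := dist_comm _ _
      calc dist (y m) (y (f i)) ≤ dist (y m) (y (f a)) + dist (y (f a)) (y (f i)) :=
            dist_triangle _ _ _
        _ = nearestDist y (f a) + dist (y (f a)) (y (f i)) := by
            rw [hdm, dist_comm (y m) (y (f a))]
        _ ≤ (1 + η) * nearestDist y (f i) + (1 + η) * nearestDist y (f i) := by linarith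
        _ = 2 * (1 + η) * nearestDist y (f i) := by ring
    obtain ⟨b, rfl⟩ := hmS
    exact nearestDist_comp_eq_of_attained y f (f.injective.ne_iff.1 hm) hdm
  -- (c) the bonds at `f i` are the same in `y` and in `y ∘ f`
  have hadj_i : ∀ a : κ, (bondGraph η y).Adj (f i) (f a) ↔ (bondGraph η (y ∘ f)).Adj i a := by
    intro a
    rw [bondGraph_adj, bondGraph_adj]
    constructor
    · rintro ⟨hne, hle⟩
      have hd : dist (y (f i)) (y (f a)) ≤ (1 + η) * nearestDist y (f i) :=
        hle.trans (mul_le_mul_of_nonneg_left (min_le_left _ _) hη1)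
      refine ⟨f.injective.ne_iff.1 hne, ?_⟩
      show dist (y (f i)) (y (f a)) ≤ (1 + η) * min (nearestDist (y ∘ f) i) (nearestDist (y ∘ f) a)
      rw [hnn_i, hnn_eq a hd]
      exact hle
    · rintro ⟨hne, hle⟩
      change dist (y (f i)) (y (f a)) ≤
        (1 + η) * min (nearestDist (y ∘ f) i) (nearestDist (y ∘ f) a) at hle
      rw [hnn_i] at hle
      have hd : dist (y (f i)) (y (f a)) ≤ (1 + η) * nearestDist y (f i) :=
        hle.trans (mul_le_mul_of_nonneg_left (min_le_left _ _) hη1)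
      rw [hnn_eq a hd] at hle
      exact ⟨f.injective.ne hne, hle⟩
  -- a bond at `f i` lands in the range
  have hmem : ∀ k, (bondGraph η y).Adj (f i) k → k ∈ Set.range f := fun k hk =>
    hball k ((bondGraph_adj.1 hk).2.trans (mul_le_mul_of_nonneg_left (min_le_left _ _) hη1))
  -- (d) bonds between two bond-neighbours of `f i` are the same in `y` and in `y ∘ f`
  have hadj_jk : ∀ a b : κ, (bondGraph η y).Adj (f i) (f a) → (bondGraph η y).Adj (f i) (f b) →
      ((bondGraph η y).Adj (f a) (f b) ↔ (bondGraph η (y ∘ f)).Adj a b) := by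
    intro a b ha hb
    have hda : dist (y (f i)) (y (f a)) ≤ (1 + η) * nearestDist y (f i) :=
      (bondGraph_adj.1 ha).2.trans (mul_le_mul_of_nonneg_left (min_le_left _ _) hη1)
    have hdb : dist (y (f i)) (y (f b)) ≤ (1 + η) * nearestDist y (f i) :=
      (bondGraph_adj.1 hb).2.trans (mul_le_mul_of_nonneg_left (min_le_left _ _) hη1)
    rw [bondGraph_adj, bondGraph_adj]
    change _ ↔ (a ≠ b ∧ dist (y (f a)) (y (f b)) ≤
      (1 + η) * min (nearestDist (y ∘ f) a) (nearestDist (y ∘ f) b))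
    rw [hnn_eq a hda, hnn_eq b hdb, f.injective.ne_iff]
  -- (e) neighbour sets and common-neighbour sets correspond under `f`
  have hNi : (bondGraph η y).neighborSet (f i) = f '' (bondGraph η (y ∘ f)).neighborSet i := by
    ext k
    simp only [SimpleGraph.mem_neighborSet, Set.mem_image]
    constructor
    · intro hk
      obtain ⟨a, rfl⟩ := hmem k hk
      exact ⟨a, (hadj_i a).1 hk, rfl⟩
    · rintro ⟨a, ha, rfl⟩
      exact (hadj_i a).2 ha
  have hNN : ∀ a : κ, (bondGraph η (y ∘ f)).Adj i a →
      (bondGraph η y).neighborSet (f i) ∩ (bondGraph η y).neighborSet (f a) =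
        f '' ((bondGraph η (y ∘ f)).neighborSet i ∩ (bondGraph η (y ∘ f)).neighborSet a) := by
    intro a ha
    have ha' : (bondGraph η y).Adj (f i) (f a) := (hadj_i a).2 ha
    ext k
    simp only [Set.mem_inter_iff, SimpleGraph.mem_neighborSet, Set.mem_image]
    constructor
    · rintro ⟨hik, hak⟩
      obtain ⟨b, rfl⟩ := hmem k hik
      exact ⟨b, ⟨(hadj_i b).1 hik, (hadj_jk a b ha' hik).1 hak⟩, rfl⟩
    · rintro ⟨b, ⟨hib, hab⟩, rfl⟩
      have hib' : (bondGraph η y).Adj (f i) (f b) := (hadj_i b).2 hib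
      exact ⟨hib', (hadj_jk a b ha' hib').2 hab⟩
  -- (f) assemble
  rw [isChargeFree_iff, isChargeFree_iff, hNi, Set.ncard_image_of_injective _ f.injective]
  refine and_congr_right fun _ => ⟨fun H a ha => ?_, fun H k hk => ?_⟩
  · have h4 := H (f a) ⟨a, ha, rfl⟩
    rw [ringNumber_def, hNN a ha, Set.ncard_image_of_injective _ f.injective, ← ringNumber_def]
      at h4
    exact h4
  · obtain ⟨a, ha, rfl⟩ := hk
    rw [ringNumber_def, hNN a ha, Set.ncard_image_of_injective _ f.injective, ← ringNumber_def]
    exact H a ha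

end ChargeLocality

/-- **Charge locality** (registered form): for `0 ≤ η` and a sub-configuration `y ∘ f` (`f : Fin M ↪ Fin N`) of a finite configuration `y : Fin N → ℝ³` whose range contains every site within `2(1+η)·nn_{f i}` of `y (f i)`, the site `f i` is charge-free in `y` iff `i` is charge-free in `y ∘ f`. [folklore] -/
theorem isChargeFree_sub_iff :
    ∀ (η : ℝ), 0 ≤ η → ∀ (N M : ℕ) (y : Fin N → EuclideanSpace ℝ (Fin 3)) (f : Fin M ↪ Fin N)
      (i : Fin M), (∀ k : Fin N, dist (y k) (y (f i)) ≤ 2 * (1 + η) * nearestDist y (f i) →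
        k ∈ Set.range f) → (IsChargeFree η y (f i) ↔ IsChargeFree η (y ∘ f) i) := by
  intro η hη N M y f i hS
  exact isChargeFree_comp_embedding_iff hη y f i hS

end Summit.AtomisticToContinuum.Crystallization.Theorems.PricedLinkCensusTruncatedCensusGap

end
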